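import Summits.CriticalPhenomena.PercolationContinuityZ3.Theorems.Transplant.GridCoverNets
import Summits.CriticalPhenomena.PercolationContinuityZ3.Theorems.Transplant.PlanarSkeletonFrmScaledDefs
import HarnessLib

/-!
# The SODALITE net (`sod`) carries NO planar unit-step skeleton — `PlanarSkeletonFrm`, `PlanarSkeletonNeg`, `PlanarSkeletonSign`,
# `PlanarSkeletonConc` are EMPTY for EVERY chart (a kernel method-void certificate by the square and rectangle laws on eight rings)

builds on p205010 (kernel theorem, internal audit signed; external expert review pending) — nothing in this file uses p205010.
Lane `prim-bschramm`, seat `prim-bschramm-p4` (gen 19; PART C3, `HOME/bschramm/P4-GENERAL.md` §41).  Helper file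
(`--supports stmt-CriticalPhenomena-4575 --as helper`).

THE NET.  `sod` = the 1-skeleton of the tiling of space by truncated octahedra (Kelvin / sodalite cage net): the points `p ∈ ℤ³` whose residues
`mod 4` are `{0, 2, odd}` in some order, bonds at squared distance `2`; 4-regular, vertex symbol `4·4·6·6·6·6`.  Translation lattice bcc with
cell `4` (`(4,0,0), (0,4,0), (2,2,2)`), six classes (representatives `(0,1,2), (0,2,1), (0,2,3), (0,3,2), (1,0,2), (1,2,0)`).  Integer model on
`ℤ³`: the site `(n₁, n₂, 6 n₃ + c)` stands for `r_c + n₁ (4,0,0) + n₂ (0,4,0) + n₃ (2,2,2)`; bond table `Sod.bonds` (class `c = x₂ mod 6`).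
4-regular (`Sod.degree_eq`); coordination sequence `4, 10, 20, 34, 52, 74, 100, …` = RCSR `sod` (checked numerically in the seat,
`HOME/prim-bschramm-p4-g19/cover/`).
THE CERTIFICATE.  Let `φ` carry the field (ι); at `o = (0,0,0)` (geometrically `(0,1,2)`) let `p, q, r, s` be the codes of the darts towards
`(0,2,1), (0,2,3), (1,0,2), (−1,0,2)`.  The square at `o` through `(0,2,1), (0,2,3)` forces `p ⊥ q` (square law), hence `{r, s} = {−p, −q}`.
The four hexagons at `o` using one of these two and one of the other two darts have first steps `(s, m₁, p), (p, n₁, r), (s, m₂, q), (q, n₂, r)`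
(shared darts identified by hexagon antipodality), and the squares at `(0,2,1)`, `(0,2,3)`, `(1,0,2)` force `m₁ ⊥ n₁`, `m₂ ⊥ n₂`, `n₁ ⊥ n₂`.  The
rectangle law on the four triples is then contradictory (`GridCover.sod_codes_false₁/₂`, `decide` over `4⁶` codes each).  Hence
**`Sod.isEmpty_planarSkeletonFrm`**, `…Neg`, `…Sign`, `…Conc`: the lane's "sod: method-void (no affine chart)" (P2-LATTICES §49) for ALL charts.
[cite: KozmaNitzan2024, §4 p. 15 (outward steps), p. 16 (Lemma 8)] [cite: ConwaySloane1999, Ch. 4 §7.1 (cubic lattices; the bcc Voronoi cell)]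
-/

namespace Summit.CriticalPhenomena.PercolationContinuityZ3.Theorems.Transplant

open Literature.Probability.Percolation Literature.Probability.LatticeModels SimpleGraph GridCover

namespace GridCover

/-- Four pairwise distinct codes with `p ⊥ q` pair off as `{r, s} = {−p, −q}`. [folklore] -/
theorem sod_codes_cases : ∀ p q r s : Fin 4, p ≠ q → p ≠ r → p ≠ s → q ≠ r → q ≠ s → r ≠ s → axis p ≠ axis q →
    (r = opp p ∧ s = opp q) ∨ (r = opp q ∧ s = opp p) := by
  decide

/-- Boolean form of the constraint system in case `r = −p, s = −q` (one atom for `decide`). [folklore] -/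
def sodTest₁ (p q m₁ n₁ m₂ n₂ : Fin 4) : Bool :=
  (axis p != axis q) && rect (opp q) m₁ p && rect p n₁ (opp p) && (axis m₁ != axis n₁) &&
    rect (opp q) m₂ q && rect q n₂ (opp p) && (axis m₂ != axis n₂) && (axis n₁ != axis n₂)

/-- Boolean form of the constraint system in case `r = −q, s = −p`. [folklore] -/
def sodTest₂ (p q m₁ n₁ m₂ n₂ : Fin 4) : Bool :=
  (axis p != axis q) && rect (opp p) m₁ p && rect p n₁ (opp q) && (axis m₁ != axis n₁) &&
    rect (opp p) m₂ q && rect q n₂ (opp q) && (axis m₂ != axis n₂) && (axis n₁ != axis n₂)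

/-- The first system has no solution (`decide` over `4⁶` codes). [folklore] -/
theorem sodTest₁_eq_false : ∀ p q m₁ n₁ m₂ n₂ : Fin 4, sodTest₁ p q m₁ n₁ m₂ n₂ = false := by decide

/-- The second system has no solution (`decide` over `4⁶` codes). [folklore] -/
theorem sodTest₂_eq_false : ∀ p q m₁ n₁ m₂ n₂ : Fin 4, sodTest₂ p q m₁ n₁ m₂ n₂ = false := by decide

/-- **The sodalite code contradiction, case `r = −p, s = −q`.** [folklore] -/
theorem sod_codes_false₁ (p q m₁ n₁ m₂ n₂ : Fin 4) (h₁ : axis p ≠ axis q)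
    (h₂ : rect (opp q) m₁ p = true) (h₃ : rect p n₁ (opp p) = true) (h₄ : axis m₁ ≠ axis n₁)
    (h₅ : rect (opp q) m₂ q = true) (h₆ : rect q n₂ (opp p) = true) (h₇ : axis m₂ ≠ axis n₂) (h₈ : axis n₁ ≠ axis n₂) : False := by
  have h := sodTest₁_eq_false p q m₁ n₁ m₂ n₂
  have e₁ : (axis p != axis q) = true := by simpa [bne_iff_ne] using h₁
  have e₄ : (axis m₁ != axis n₁) = true := by simpa [bne_iff_ne] using h₄
  have e₇ : (axis m₂ != axis n₂) = true := by simpa [bne_iff_ne] using h₇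
  have e₈ : (axis n₁ != axis n₂) = true := by simpa [bne_iff_ne] using h₈
  simp only [sodTest₁, e₁, h₂, h₃, e₄, h₅, h₆, e₇, e₈, Bool.and_self] at h
  exact Bool.noConfusion h

/-- **The sodalite code contradiction, case `r = −q, s = −p`.** [folklore] -/
theorem sod_codes_false₂ (p q m₁ n₁ m₂ n₂ : Fin 4) (h₁ : axis p ≠ axis q)
    (h₂ : rect (opp p) m₁ p = true) (h₃ : rect p n₁ (opp q) = true) (h₄ : axis m₁ ≠ axis n₁)
    (h₅ : rect (opp p) m₂ q = true) (h₆ : rect q n₂ (opp q) = true) (h₇ : axis m₂ ≠ axis n₂) (h₈ : axis n₁ ≠ axis n₂) : False := by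
  have h := sodTest₂_eq_false p q m₁ n₁ m₂ n₂
  have e₁ : (axis p != axis q) = true := by simpa [bne_iff_ne] using h₁
  have e₄ : (axis m₁ != axis n₁) = true := by simpa [bne_iff_ne] using h₄
  have e₇ : (axis m₂ != axis n₂) = true := by simpa [bne_iff_ne] using h₇
  have e₈ : (axis n₁ != axis n₂) = true := by simpa [bne_iff_ne] using h₈
  simp only [sodTest₂, e₁, h₂, h₃, e₄, h₅, h₆, e₇, e₈, Bool.and_self] at h
  exact Bool.noConfusion h

end GridCover

namespace Sod

/-! ## §1 The sodalite graph on `ℤ³` -/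

/-- The bond table of `sod` (class `c = x₂ mod 6`). [cite: ConwaySloane1999, Ch. 4 §7.1] -/
def bonds : Fin 6 → Finset (Site 3) :=
  ![{![-1, -1, 11], ![0, 0, 1], ![0, 0, 2], ![0, 0, 4]},
    {![0, 0, -1], ![0, 0, 2], ![0, 0, 4], ![0, 1, -3]},
    {![-1, -1, 15], ![-1, 0, 8], ![0, 0, -2], ![0, 0, 1]},
    {![-1, 0, 8], ![0, 0, -2], ![0, 0, -1], ![0, 1, 1]},
    {![0, -1, -1], ![0, -1, 3], ![0, 0, -4], ![1, 0, -8]},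
    {![0, 0, -4], ![1, 0, -8], ![1, 1, -15], ![1, 1, -11]}]

/-- No zero bond. [folklore] -/
theorem zero_notMem_bonds : ∀ c, (0 : Site 3) ∉ bonds c := by decide

/-- **The bond table is symmetric.** [folklore] -/
theorem neg_mem_bonds : ∀ c, ∀ v ∈ bonds c, -v ∈ bonds (TableNet.tgt 5 c v) := by decide

/-- Four bonds at every site. [folklore] -/
theorem card_bonds : ∀ c, (bonds c).card = 4 := by decide

/-- **The sodalite graph.** [cite: ConwaySloane1999, Ch. 4 §7.1] -/
def graph : SimpleGraph (Site 3) := TableNet.graph 5 bonds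

/-- The sodalite graph is locally finite. [folklore] -/
noncomputable instance graph_locallyFinite : graph.LocallyFinite := TableNet.graph_locallyFinite

/-- **`sod` is 4-regular.** [cite: ConwaySloane1999, Ch. 4 §7.1] -/
theorem degree_eq (x : Site 3) : graph.degree x = 4 := TableNet.degree_eq zero_notMem_bonds neg_mem_bonds card_bonds x

/-- A table bond is an edge. [folklore] -/
theorem adj_of_mem {x y : Site 3} (h : y - x ∈ bonds (TableNet.cls 5 x)) : graph.Adj x y := TableNet.adj_of_mem zero_notMem_bonds h

/-! ## §2 Four hexagons and four squares around `o = (0,0,0)` -/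

/-- Hexagon X1: `o → s-dart → … → p-dart⁻¹ → o`. [folklore] -/
noncomputable def hexX1 : GridHexagon graph where
  v₀ := ![0, 0, 0]
  v₁ := ![-1, -1, 11]
  v₂ := ![0, 0, -4]
  v₃ := ![0, 0, -3]
  v₄ := ![0, 1, -2]
  v₅ := ![0, 0, 1]
  h₀₁ := adj_of_mem (by decide)
  h₁₂ := adj_of_mem (by decide)
  h₂₃ := adj_of_mem (by decide)
  h₃₄ := adj_of_mem (by decide)
  h₄₅ := adj_of_mem (by decide)
  h₅₀ := adj_of_mem (by decide)
  n₀₂ := by decide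
  n₁₃ := by decide
  n₂₄ := by decide
  n₃₅ := by decide
  n₄₀ := by decide
  n₅₁ := by decide
  d₀ := (degree_eq _).le
  d₁ := (degree_eq _).le
  d₂ := (degree_eq _).le
  d₃ := (degree_eq _).le
  d₄ := (degree_eq _).le
  d₅ := (degree_eq _).le

/-- Hexagon X2: `o → s-dart → … → q-dart⁻¹ → o`. [folklore] -/
noncomputable def hexX2 : GridHexagon graph where
  v₀ := ![0, 0, 0]
  v₁ := ![-1, -1, 11]
  v₂ := ![-1, -1, 7]
  v₃ := ![-1, -1, 9]
  v₄ := ![-1, 0, 10]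
  v₅ := ![0, 0, 2]
  h₀₁ := adj_of_mem (by decide)
  h₁₂ := adj_of_mem (by decide)
  h₂₃ := adj_of_mem (by decide)
  h₃₄ := adj_of_mem (by decide)
  h₄₅ := adj_of_mem (by decide)
  h₅₀ := adj_of_mem (by decide)
  n₀₂ := by decide
  n₁₃ := by decide
  n₂₄ := by decide
  n₃₅ := by decide
  n₄₀ := by decide
  n₅₁ := by decide
  d₀ := (degree_eq _).le
  d₁ := (degree_eq _).le
  d₂ := (degree_eq _).le
  d₃ := (degree_eq _).le
  d₄ := (degree_eq _).le
  d₅ := (degree_eq _).le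

/-- Hexagon X3: `o → p-dart → … → r-dart⁻¹ → o`. [folklore] -/
noncomputable def hexX3 : GridHexagon graph where
  v₀ := ![0, 0, 0]
  v₁ := ![0, 0, 1]
  v₂ := ![0, 0, 5]
  v₃ := ![1, 0, -3]
  v₄ := ![1, 0, -4]
  v₅ := ![0, 0, 4]
  h₀₁ := adj_of_mem (by decide)
  h₁₂ := adj_of_mem (by decide)
  h₂₃ := adj_of_mem (by decide)
  h₃₄ := adj_of_mem (by decide)
  h₄₅ := adj_of_mem (by decide)
  h₅₀ := adj_of_mem (by decide)
  n₀₂ := by decide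
  n₁₃ := by decide
  n₂₄ := by decide
  n₃₅ := by decide
  n₄₀ := by decide
  n₅₁ := by decide
  d₀ := (degree_eq _).le
  d₁ := (degree_eq _).le
  d₂ := (degree_eq _).le
  d₃ := (degree_eq _).le
  d₄ := (degree_eq _).le
  d₅ := (degree_eq _).le

/-- Hexagon X4: `o → q-dart → … → r-dart⁻¹ → o`. [folklore] -/
noncomputable def hexX4 : GridHexagon graph where
  v₀ := ![0, 0, 0]
  v₁ := ![0, 0, 2]
  v₂ := ![-1, -1, 17]
  v₃ := ![0, -1, 9]
  v₄ := ![0, -1, 7]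
  v₅ := ![0, 0, 4]
  h₀₁ := adj_of_mem (by decide)
  h₁₂ := adj_of_mem (by decide)
  h₂₃ := adj_of_mem (by decide)
  h₃₄ := adj_of_mem (by decide)
  h₄₅ := adj_of_mem (by decide)
  h₅₀ := adj_of_mem (by decide)
  n₀₂ := by decide
  n₁₃ := by decide
  n₂₄ := by decide
  n₃₅ := by decide
  n₄₀ := by decide
  n₅₁ := by decide
  d₀ := (degree_eq _).le
  d₁ := (degree_eq _).le
  d₂ := (degree_eq _).le
  d₃ := (degree_eq _).le
  d₄ := (degree_eq _).le
  d₅ := (degree_eq _).le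

/-- Square S1 at `o` through the `p`- and `q`-darts. [folklore] -/
noncomputable def sqS1 : GridSquare graph where
  v₀ := ![0, 0, 0]
  v₁ := ![0, 0, 1]
  v₂ := ![0, 0, 3]
  v₃ := ![0, 0, 2]
  h₀₁ := adj_of_mem (by decide)
  h₁₂ := adj_of_mem (by decide)
  h₂₃ := adj_of_mem (by decide)
  h₃₀ := adj_of_mem (by decide)
  n₀₂ := by decide
  n₁₃ := by decide
  d₀ := (degree_eq _).le
  d₁ := (degree_eq _).le
  d₂ := (degree_eq _).le
  d₃ := (degree_eq _).le

/-- Square S2 at `(0,0,1)` through the `m₁`- and `n₁`-darts. [folklore] -/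
noncomputable def sqS2 : GridSquare graph where
  v₀ := ![0, 0, 1]
  v₁ := ![0, 1, -2]
  v₂ := ![1, 1, -10]
  v₃ := ![0, 0, 5]
  h₀₁ := adj_of_mem (by decide)
  h₁₂ := adj_of_mem (by decide)
  h₂₃ := adj_of_mem (by decide)
  h₃₀ := adj_of_mem (by decide)
  n₀₂ := by decide
  n₁₃ := by decide
  d₀ := (degree_eq _).le
  d₁ := (degree_eq _).le
  d₂ := (degree_eq _).le
  d₃ := (degree_eq _).le

/-- Square S3 at `(0,0,2)` through the `m₂`- and `n₂`-darts. [folklore] -/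
noncomputable def sqS3 : GridSquare graph where
  v₀ := ![0, 0, 2]
  v₁ := ![-1, 0, 10]
  v₂ := ![-1, -1, 13]
  v₃ := ![-1, -1, 17]
  h₀₁ := adj_of_mem (by decide)
  h₁₂ := adj_of_mem (by decide)
  h₂₃ := adj_of_mem (by decide)
  h₃₀ := adj_of_mem (by decide)
  n₀₂ := by decide
  n₁₃ := by decide
  d₀ := (degree_eq _).le
  d₁ := (degree_eq _).le
  d₂ := (degree_eq _).le
  d₃ := (degree_eq _).le

/-- Square S4 at `(0,0,4)` through the `n₁`- and `n₂`-darts. [folklore] -/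
noncomputable def sqS4 : GridSquare graph where
  v₀ := ![0, 0, 4]
  v₁ := ![1, 0, -4]
  v₂ := ![0, -1, 11]
  v₃ := ![0, -1, 7]
  h₀₁ := adj_of_mem (by decide)
  h₁₂ := adj_of_mem (by decide)
  h₂₃ := adj_of_mem (by decide)
  h₃₀ := adj_of_mem (by decide)
  n₀₂ := by decide
  n₁₃ := by decide
  d₀ := (degree_eq _).le
  d₁ := (degree_eq _).le
  d₂ := (degree_eq _).le
  d₃ := (degree_eq _).le

/-! ## §3 The certificate -/

/-- **No chart on `sod` has the outward-step field (ι).** [cite: KozmaNitzan2024, §4 p. 15] -/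
theorem false_of_unitSteps {φ : Site 3 → Site 2}
    (hstep : ∀ (v : Site 3) (i : Fin 2) (σ : ℤˣ), ∃ v' : Site 3, graph.Adj v v' ∧ φ v' = φ v + Pi.single i (σ : ℤ)) : False := by
  obtain ⟨x0, x1, x2, hx0, -, -, -, hx4, hx5, px⟩ := hexX1.rect hstep
  obtain ⟨w0, w1, w2, hw0, -, -, -, hw4, hw5, pw⟩ := hexX2.rect hstep
  obtain ⟨y0, y1, y2, hy0, hy1, -, -, hy4, hy5, py⟩ := hexX3.rect hstep
  obtain ⟨z0, z1, z2, hz0, hz1, -, -, hz4, hz5, pz⟩ := hexX4.rect hstep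
  obtain ⟨a0, a1, a2, a3, ha0, -, -, ha3, -, ea3, qa⟩ := sqS1.codes hstep
  obtain ⟨b0, b1, b2, b3, hb0, -, -, hb3, -, eb3, qb⟩ := sqS2.codes hstep
  obtain ⟨c0, c1, c2, c3, hc0, -, -, hc3, -, ec3, qc⟩ := sqS3.codes hstep
  obtain ⟨d0, d1, d2, d3, hd0, -, -, hd3, -, ed3, qd⟩ := sqS4.codes hstep
  -- names: p := y0 (dart o → (0,0,1)), q := z0 (o → (0,0,2)), r := y2 (o → (0,0,4)), s := x0 (o → (-1,-1,11)); m₁ := x1, n₁ := y1, m₂ := w1, n₂ := z1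
  have hr : φ hexX3.v₅ - φ hexX3.v₀ = vec y2 := by rw [← opp_opp y2, vec_opp, ← hy5, neg_sub]
  -- identifications of shared / reversed darts
  have e_x2 : x2 = y0 := opp_injective (code_reverse hy0 hx5)
  have e_w0 : w0 = x0 := code_unique hw0 hx0
  have e_w2 : w2 = z0 := opp_injective (code_reverse hz0 hw5)
  have e_z2 : z2 = y2 := opp_injective (code_unique hz5 hy5)
  have e_a0 : a0 = y0 := code_unique ha0 hy0
  have e_a1 : a1 = z0 := opp_injective (ea3 ▸ code_reverse hz0 ha3)
  have e_b0 : b0 = x1 := (code_reverse hx4 hb0).trans (opp_opp x1)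
  have e_b1 : b1 = y1 := opp_injective (eb3 ▸ code_reverse hy1 hb3)
  have e_c0 : c0 = w1 := (code_reverse hw4 hc0).trans (opp_opp w1)
  have e_c1 : c1 = z1 := opp_injective (ec3 ▸ code_reverse hz1 hc3)
  have e_d0 : d0 = y1 := (code_reverse hy4 hd0).trans (opp_opp y1)
  have e_d1 : d1 = z1 := opp_injective (ed3 ▸ code_unique hd3 hz4)
  rw [e_x2] at px
  rw [e_w0, e_w2] at pw
  rw [e_z2] at pz
  rw [e_a0, e_a1] at qa
  rw [e_b0, e_b1] at qb
  rw [e_c0, e_c1] at qc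
  rw [e_d0, e_d1] at qd
  -- the four darts at `o` are pairwise distinct
  have v0 := (degree_eq hexX3.v₀).le
  have npq := code_ne_of_ne hstep v0 hexX3.h₀₁ hexX4.h₀₁ (by decide) hy0 hz0
  have npr := code_ne_of_ne hstep v0 hexX3.h₀₁ hexX3.h₅₀.symm (by decide) hy0 hr
  have nps := code_ne_of_ne hstep v0 hexX3.h₀₁ hexX1.h₀₁ (by decide) hy0 hx0
  have nqr := code_ne_of_ne hstep v0 hexX4.h₀₁ hexX3.h₅₀.symm (by decide) hz0 hr
  have nqs := code_ne_of_ne hstep v0 hexX4.h₀₁ hexX1.h₀₁ (by decide) hz0 hx0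
  have nrs := code_ne_of_ne hstep v0 hexX3.h₅₀.symm hexX1.h₀₁ (by decide) hr hx0
  rcases sod_codes_cases y0 z0 y2 x0 npq npr nps nqr nqs nrs qa.symm with ⟨er, es⟩ | ⟨er, es⟩
  · rw [er] at py pz; rw [es] at px pw
    exact sod_codes_false₁ y0 z0 x1 y1 w1 z1 qa.symm px py qb.symm pw pz qc.symm qd.symm
  · rw [er] at py pz; rw [es] at px pw
    exact sod_codes_false₂ y0 z0 x1 y1 w1 z1 qa.symm px py qb.symm pw pz qc.symm qd.symm

/-- **THEOREM (kernel no-go): `sod` carries no `PlanarSkeletonFrm`.** [cite: KozmaNitzan2024, §4 p. 15] -/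
theorem isEmpty_planarSkeletonFrm : IsEmpty (PlanarSkeletonFrm graph) := ⟨fun Φ => false_of_unitSteps Φ.step⟩

/-- **… no `PlanarSkeletonNeg`.** [cite: KozmaNitzan2024, §4 p. 16 (Lemma 8)] -/
theorem isEmpty_planarSkeletonNeg : IsEmpty (PlanarSkeletonNeg graph) := ⟨fun Φ => false_of_unitSteps Φ.step⟩

/-- **… no `PlanarSkeletonSign`.** [cite: KozmaNitzan2024, §4 p. 16 (Lemma 8)] -/
theorem isEmpty_planarSkeletonSign : IsEmpty (PlanarSkeletonSign graph) := ⟨fun Φ => false_of_unitSteps Φ.step⟩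

/-- **… and no `PlanarSkeletonConc`.** [cite: KozmaNitzan2024, §4 p. 16 (Lemma 8)] -/
theorem isEmpty_planarSkeletonConc : IsEmpty (PlanarSkeletonConc graph) := ⟨fun Φ => false_of_unitSteps Φ.step⟩

/-- **… no `PlanarSkeletonFrmFrom`** (the universal one-type node U's interface). [cite: KozmaNitzan2024, §4 p. 15] -/
theorem isEmpty_planarSkeletonFrmFrom : IsEmpty (PlanarSkeletonFrmFrom graph) := ⟨fun Φ => false_of_unitSteps Φ.step⟩

/-- **… and no `PlanarSkeletonFrmScaled` — for ANY step length `N` and ANY Lipschitz constant**: the coarse chart `⌊φ/N⌋` of a scaled skeleton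
has unit steps (`PlanarSkeletonFrmScaled.steps_coarse`) and the certificate uses nothing but the steps; so no multi-type version of the scaled
node could reach this net either — it needs QUASI-steps (steps along bounded paths). [cite: KozmaNitzan2024, §4 p. 15] -/
theorem isEmpty_planarSkeletonFrmScaled : IsEmpty (PlanarSkeletonFrmScaled graph) := ⟨fun Φ => false_of_unitSteps Φ.steps_coarse⟩

end Sod

end Summit.CriticalPhenomena.PercolationContinuityZ3.Theorems.Transplant
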